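import Summits.QuantumFields.BalabanUV.T4Continuum.Support.VariationalTower
import Summits.QuantumFields.BalabanUV.T4Continuum.Support.VariationalRegularity

/-!
# T⁴ programme, spine node NE2 (U1a), lane P2 — TIER 0 OF THE VARIATIONAL ROUTE CLOSED: row NE2's wall shape
# `OneStepAveragedLaw` inhabited by Bałaban's `U = 1` effective actions with NO hypothesis
# (`t4/skeletons/NE2-t4-ne2-p2.md` §2–§3; cell `pub-balaban`, row NE2 co-owner #2, lineage t4-ne2-p2 gen 9)

HONEST FRAMING (T4-DAG p. 1): rung (B)+1 only — NOT infinite volume, NOT a mass gap, NOT Clay.  This two-line module composes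
`VariationalTower.oneStepAveragedLaw_effMat` (the wall shape modulo the L²-regularity leaf L0-REG) with
`VariationalRegularity.minimiserRegularityL2_holds` (L0-REG proved, `C_reg = 4d/γ₀`).  What it IS: the `U = 1` (no background)
effective-action species of row NE2 in the NE5 socket's currency `CovariantAveragingTower.OneStepAveragedLaw`, identity
averagings, rate `θ = L⁻²`, explicit constant `Cop d (4d/γ₀)`.  What it is NOT: the background tier NE2⁺ (hypothesis shape
`VariationalLeaves.CovariantStepLaws`, needs NE3), nor any of the other eight spine estimates.  HONEST DEPENDENCY (cell,
verbatim): continuum YM on T⁴ ⇐ BetaPertH ∧ nine spine estimates (0/9 proved); BetaPertH ⇐ (D1) ∧ (D4) ∧ CAP+tail; G-an2-4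
gates asym, D1 and NE2/3/4.  No `sorry`; axioms ⊆ {propext, Classical.choice, Quot.sound}; nothing printed is a hypothesis.
-/

noncomputable section

namespace Summit.QuantumFields.BalabanUV.T4Continuum.VariationalTowerClosed

open scoped Matrix Matrix.Norms.L2Operator
open Summit.QuantumFields.BalabanUV.T4Continuum.CovariantAveragingTower (OneStepAveragedLaw)
open Summit.QuantumFields.BalabanUV.T4Continuum.VariationalTower (effMat Cop oneStepAveragedLaw_effMat)
open Summit.QuantumFields.BalabanUV.T4Continuum.VariationalRegularity (minimiserRegularityL2_holds)
open Literature.MathematicalPhysics.QuantumFieldTheory.Balaban1983to89.B5Prop11Plancherel (Tor)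
open Literature.MathematicalPhysics.QuantumFieldTheory.Balaban1983to89.T4GaugeActionRate (gam0 gam0_pos)

variable {d : ℕ} (M : Fin d → ℕ) [∀ μ, NeZero (M μ)]

/-- **ROW NE2's WALL SHAPE, INHABITED UNCONDITIONALLY ALONG THE VARIATIONAL ROUTE** (`U = 1` effective-action species, tier 0):
the tower `k ↦ effMat (L^k) M` of Bałaban's `U = 1` k-step effective actions on the unit torus obeys
`OneStepAveragedLaw (fun _ ↦ 1) 1 (k ↦ Δ_k) (k ↦ Cop d (4d/γ₀)·(L⁻²)^k)` for every block side `L ≥ 1` — NO hypothesis.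
[folklore] -/
theorem oneStepAveragedLaw_effMat_holds (L : ℕ) [NeZero L] :
    OneStepAveragedLaw (ι := fun _ => Tor M × Fin d) (fun _ => (1 : Matrix (Tor M × Fin d) (Tor M × Fin d) ℂ)) 1
      (fun k => effMat (L ^ k) M) (fun k => Cop d (4 * d / gam0 d) * (((L : ℝ) ^ 2)⁻¹) ^ k) :=
  oneStepAveragedLaw_effMat M L (minimiserRegularityL2_holds d) (by have := gam0_pos d; positivity)

/-- the same as an explicit operator-norm rate: `‖Δ_{k+1} − Δ_k‖ ≤ Cop d (4d/γ₀)·(L⁻²)^k` for every `k`. [folklore] -/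
theorem opNorm_effMat_succ_sub_le_holds (L : ℕ) [NeZero L] (k : ℕ) :
    ‖effMat (L ^ (k + 1)) M - effMat (L ^ k) M‖ ≤ Cop d (4 * d / gam0 d) * (((L : ℝ) ^ 2)⁻¹) ^ k :=
  VariationalTower.opNorm_effMat_succ_sub_le M L (minimiserRegularityL2_holds d) (by have := gam0_pos d; positivity) k

end Summit.QuantumFields.BalabanUV.T4Continuum.VariationalTowerClosed
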